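import Summits.QuantumFields.GaugeBoot.Certificates.SparseReducedWindowH
import HarnessLib

/-!
# Sparse certificate replay, part 5e: sign-dispatch Gram dot products (ℕ accumulators)

HONEST FRAMING (cell `pub-gaugeboot`): certified bounds on lattice expectations at stated coupling,
gauge group, dimension and torus size; NOT a mass gap, NOT a continuum limit, NOT a string tension;
NOT Yang–Mills-summit-bearing (barriers `FixedCouplingUltralocality`, `PerturbativeInvisibility`).

Sequel of part 5d (`SparseReducedWindowH.lean`).  The Gram value `⟨G_i, G_j⟩` of a touched entry is computed by
`dotPN`: the products `|a_r| · |b_r|` are added into a POSITIVE or a NEGATIVE natural-number accumulator according to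
the signs of the integer literals `a_r`, `b_r` (`Int.ofNat` / `Int.negSucc` ARE sign-magnitude), and the two sums are
subtracted once at the end (`Int.subNatNat`).  This avoids the structural unfolding of `Int.mul` / `Int.add`
(`negOfNat`, `subNatNat` per step) in the kernel: all 257 k multiply-adds of the tree certificate `KZL2rpD4b3Up` take
25.8 s instead of 38.2 s (`listDotR`) / 48.5 s (`listDot`) on the farm (lean3 gen 7, 2026-08-22).  `dotPN a b 0 0 = listDot a b`
(`dotPN_eq`); the sweep `sweepP` / window check `winCheckP` are the part-5d ones with `dotPN` and give the SAME `WinOK`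
(`winOK_of_checkP`, `winOK_of_checkP0`).  All `[folklore]`; nothing here is specific to lattice gauge theory.
-/

namespace Summit.QuantumFields.GaugeBoot.Certificates.Sparse

open Matrix Finset Literature.Computation.Certificates

noncomputable section

/-! ## Sign-dispatch dot product -/

/-- Dot product with natural-number accumulators: `dotPN a b p n = p − n + Σ_r a_r b_r`, the products added to `p`
or `n` by the signs of the literals. [folklore] -/
def dotPN : List ℤ → List ℤ → ℕ → ℕ → ℤ :=
  @List.rec ℤ (fun _ => List ℤ → ℕ → ℕ → ℤ) (fun _ p n => Int.subNatNat p n)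
    (fun a _ ih bs p n => @List.casesOn ℤ (fun _ => ℤ) bs (Int.subNatNat p n) (fun b bs' =>
      @Int.casesOn (fun _ => ℤ) a
        (fun x => @Int.casesOn (fun _ => ℤ) b (fun y => ih bs' (Nat.add p (Nat.mul x y)) n)
          (fun y => ih bs' p (Nat.add n (Nat.mul x (Nat.succ y)))))
        (fun x => @Int.casesOn (fun _ => ℤ) b (fun y => ih bs' p (Nat.add n (Nat.mul (Nat.succ x) y)))
          (fun y => ih bs' (Nat.add p (Nat.mul (Nat.succ x) (Nat.succ y))) n))))

/-- Unfolding `dotPN` on two `cons`es. [folklore] -/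
theorem dotPN_cons_cons (a : ℤ) (as : List ℤ) (b : ℤ) (bs : List ℤ) (p n : ℕ) :
    dotPN (a :: as) (b :: bs) p n =
      @Int.casesOn (fun _ => ℤ) a
        (fun x => @Int.casesOn (fun _ => ℤ) b (fun y => dotPN as bs (Nat.add p (Nat.mul x y)) n)
          (fun y => dotPN as bs p (Nat.add n (Nat.mul x (Nat.succ y)))))
        (fun x => @Int.casesOn (fun _ => ℤ) b (fun y => dotPN as bs p (Nat.add n (Nat.mul (Nat.succ x) y)))
          (fun y => dotPN as bs (Nat.add p (Nat.mul (Nat.succ x) (Nat.succ y))) n)) := rfl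

/-- **Semantics of `dotPN`**: `dotPN a b p n = p − n + listDot a b`. [folklore] -/
theorem dotPN_eq : ∀ (a b : List ℤ) (p n : ℕ), dotPN a b p n = (p : ℤ) - n + listDot a b
  | [], b, p, n => by cases b <;> simp [dotPN, Int.subNatNat_eq_coe]
  | _ :: _, [], p, n => by simp [dotPN, Int.subNatNat_eq_coe]
  | a :: as, b :: bs, p, n => by
    rw [dotPN_cons_cons, listDot_cons_cons]
    cases a with
    | ofNat x =>
      cases b with
      | ofNat y =>
        show dotPN as bs (p + x * y) n = _
        rw [dotPN_eq as bs]; simp only [Int.ofNat_eq_natCast]; push_cast; ring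
      | negSucc y =>
        show dotPN as bs p (n + x * (y + 1)) = _
        rw [dotPN_eq as bs, Int.negSucc_eq]; simp only [Int.ofNat_eq_natCast]; push_cast; ring
    | negSucc x =>
      cases b with
      | ofNat y =>
        show dotPN as bs p (n + (x + 1) * y) = _
        rw [dotPN_eq as bs, Int.negSucc_eq]; simp only [Int.ofNat_eq_natCast]; push_cast; ring
      | negSucc y =>
        show dotPN as bs (p + (x + 1) * (y + 1)) n = _
        rw [dotPN_eq as bs, Int.negSucc_eq, Int.negSucc_eq]; push_cast; ring

/-- `dotPN a b 0 0 = listDot a b`. [folklore] -/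
theorem dotPN_zero (a b : List ℤ) : dotPN a b 0 0 = listDot a b := by
  rw [dotPN_eq]; simp

/-! ## The sweep with sign-dispatch dot products -/

/-- Row walk (sign-dispatch dot product, skip-test-first early-exit term walk). [folklore] -/
def accRowP (d lo hi : ℕ) (Gi : List ℤ) (es : List (List (ℕ × ℤ))) : Bool → List (List ℤ) → Trie → Trie :=
  @List.rec (List (ℕ × ℤ)) (fun _ => Bool → List (List ℤ) → Trie → Trie) (fun _ _ t => t)
    (fun e _ ih first Gs t =>
      ih false Gs.tail (accTermsH d lo hi (Int.mul (bif first then 1 else 2) (dotPN Gi (Gs.headD []) 0 0)) e t)) es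

/-- Unfolding `accRowP` on a `cons`. [folklore] -/
theorem accRowP_cons (d lo hi : ℕ) (Gi : List ℤ) (e : List (ℕ × ℤ)) (es : List (List (ℕ × ℤ))) (first : Bool)
    (Gs : List (List ℤ)) (t : Trie) : accRowP d lo hi Gi (e :: es) first Gs t =
      accRowP d lo hi Gi es false Gs.tail
        (accTermsH d lo hi (Int.mul (bif first then 1 else 2) (dotPN Gi (Gs.headD []) 0 0)) e t) := rfl

/-- `accRowP` is the part-5 row walk of the shifted row. [folklore] -/
theorem accRowP_eq (d lo hi : ℕ) (Gi : List ℤ) : ∀ (es : List (List (ℕ × ℤ))) (first : Bool) (Gs : List (List ℤ))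
    (t : Trie), (∀ e ∈ es, sortedFrom e 0 = true) →
    accRowP d lo hi Gi es first Gs t = accRowR d 0 (hi - lo) Gi (es.map (shiftFilter lo hi)) first Gs t
  | [], _, _, _, _ => rfl
  | e :: es, first, Gs, t, hs => by
    rw [accRowP_cons, List.map_cons, accRowR_cons, dotPN_zero,
      accTermsH_eq d lo hi _ e 0 t (hs e (by simp)),
      accRowP_eq d lo hi Gi es false Gs.tail _ fun e' he' => hs e' (by simp [he'])]

/-- Row loop of block `k`. [folklore] -/
def accIP (GB : List (List (List ℤ))) (EB : List (List (List (List (ℕ × ℤ))))) (d lo hi k : ℕ) (n : ℕ) :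
    Trie → Trie :=
  @Nat.rec (fun _ => Trie → Trie) (fun t => t)
    (fun i ih t => ih (accRowP d lo hi (grow GB k i) ((EB.getD k []).getD i []) true ((GB.getD k []).drop i) t)) n

/-- Unfolding `accIP`. [folklore] -/
theorem accIP_succ (GB : List (List (List ℤ))) (EB : List (List (List (List (ℕ × ℤ))))) (d lo hi k i : ℕ)
    (t : Trie) : accIP GB EB d lo hi k (i + 1) t =
      accIP GB EB d lo hi k i (accRowP d lo hi (grow GB k i) ((EB.getD k []).getD i []) true ((GB.getD k []).drop i) t) :=
  rfl

/-- `accIP` is the part-5 row loop on the shifted table. [folklore] -/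
theorem accIP_eq (GB : List (List (List ℤ))) {EB : List (List (List (List (ℕ × ℤ))))} (hs : sortedCheck EB = true)
    (d lo hi k : ℕ) : ∀ (n : ℕ) (t : Trie),
    accIP GB EB d lo hi k n t = accIR GB (EBshift lo hi EB) d 0 (hi - lo) k n t
  | 0, _ => rfl
  | i + 1, t => by
    rw [accIP_succ, accIR_succ, getD_EBshift, accRowP_eq d lo hi _ _ _ _ _ (sorted_of_check hs k i),
      accIP_eq GB hs d lo hi k i]

/-- Block loop. [folklore] -/
def accKP (GB : List (List (List ℤ))) (EB : List (List (List (List (ℕ × ℤ))))) (d lo hi m : ℕ) (n : ℕ) :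
    Trie → Trie :=
  @Nat.rec (fun _ => Trie → Trie) (fun t => t) (fun k ih t => ih (accIP GB EB d lo hi k m t)) n

/-- Unfolding `accKP`. [folklore] -/
theorem accKP_succ (GB : List (List (List ℤ))) (EB : List (List (List (List (ℕ × ℤ))))) (d lo hi m k : ℕ)
    (t : Trie) : accKP GB EB d lo hi m (k + 1) t = accKP GB EB d lo hi m k (accIP GB EB d lo hi k m t) := rfl

/-- `accKP` is the part-5 block loop on the shifted table. [folklore] -/
theorem accKP_eq (GB : List (List (List ℤ))) {EB : List (List (List (List (ℕ × ℤ))))} (hs : sortedCheck EB = true)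
    (d lo hi m : ℕ) : ∀ (n : ℕ) (t : Trie),
    accKP GB EB d lo hi m n t = accKR GB (EBshift lo hi EB) d 0 (hi - lo) m n t
  | 0, _ => rfl
  | k + 1, t => by rw [accKP_succ, accKR_succ, accIP_eq GB hs, accKP_eq GB hs d lo hi m k]

/-- **The early-exit sweep with sign-dispatch dot products** (kernel side). [folklore] -/
def sweepP (GB : List (List (List ℤ))) (EB : List (List (List (List (ℕ × ℤ))))) (nb m d lo hi : ℕ) : Trie :=
  accKP GB EB d lo hi m nb Trie.nil

/-- `sweepP` is the part-5 sweep of the shifted table over `0 ≤ v' < hi − lo`. [folklore] -/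
theorem sweepP_eq (GB : List (List (List ℤ))) {EB : List (List (List (List (ℕ × ℤ))))} (hs : sortedCheck EB = true)
    (nb m d lo hi : ℕ) : sweepP GB EB nb m d lo hi = sweepR GB (EBshift lo hi EB) nb m d 0 (hi - lo) :=
  accKP_eq GB hs d lo hi m nb Trie.nil

/-- `sweepP = sweepH` (same accumulator, cheaper Gram values). [folklore] -/
theorem sweepP_eq_sweepH (GB : List (List (List ℤ))) {EB : List (List (List (List (ℕ × ℤ))))} (hs : sortedCheck EB = true)
    (nb m d lo hi : ℕ) : sweepP GB EB nb m d lo hi = sweepH GB EB nb m d lo hi := by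
  rw [sweepP_eq GB hs, sweepH_eq GB hs]

/-! ## Window check -/

/-- **Window check** (early exit, skip test first, offset table, sign-dispatch dot products). [folklore] -/
def winCheckP (GB : List (List (List ℤ))) (EBH : List (List (List (List (ℕ × ℤ))))) (nb m d : ℕ)
    (cZ : List (ℕ × ℤ)) (RN : List ℤ) (P D : ℤ) (H lo hi : ℕ) (s : ℤ) : Bool :=
  decide (H ≤ lo) && decide (lo ≤ hi) && decide (hi - lo ≤ 2 ^ d) &&
    decide (resWalkE d lo (sweepP GB EBH nb m d (lo - H) (hi - H)) cZ P D (hi - lo) (RN.drop lo) lo 0 = s)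

/-- `winCheckP = winCheckH` on sorted tables. [folklore] -/
theorem winCheckP_eq_winCheckH {GB : List (List (List ℤ))} {EBH : List (List (List (List (ℕ × ℤ))))}
    (hs : sortedCheck EBH = true) (nb m d : ℕ) (cZ : List (ℕ × ℤ)) (RN : List ℤ) (P D : ℤ) (H lo hi : ℕ) (s : ℤ) :
    winCheckP GB EBH nb m d cZ RN P D H lo hi s = winCheckH GB EBH nb m d cZ RN P D H lo hi s := by
  rw [winCheckP, winCheckH, sweepP_eq_sweepH GB hs]

/-- **Soundness of `winCheckP`** for an offset table `EBH = EBshift H N EB`, `hi ≤ N`: the SAME `WinOK`. [folklore] -/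
theorem winOK_of_checkP {GB : List (List (List ℤ))} {EB EBH : List (List (List (List (ℕ × ℤ))))} {nb m d : ℕ}
    {cZ : List (ℕ × ℤ)} {RN : List ℤ} {P D : ℤ} {H N lo hi : ℕ} {s : ℤ} (hEBH : EBH = EBshift H N EB) (hN : hi ≤ N)
    (hsortH : sortedCheck EBH = true) (hrow : rowLenCheck EB m nb = true)
    (h : winCheckP GB EBH nb m d cZ RN P D H lo hi s = true) : WinOK GB EB nb m cZ RN P D lo hi s :=
  winOK_of_checkH hEBH hN hsortH hrow (by rw [← winCheckP_eq_winCheckH hsortH]; exact h)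

/-- **Soundness of `winCheckP` with the family table itself** (`H = 0`). [folklore] -/
theorem winOK_of_checkP0 {GB : List (List (List ℤ))} {EB : List (List (List (List (ℕ × ℤ))))} {nb m d : ℕ}
    {cZ : List (ℕ × ℤ)} {RN : List ℤ} {P D : ℤ} {lo hi : ℕ} {s : ℤ}
    (hsort : sortedCheck EB = true) (hrow : rowLenCheck EB m nb = true)
    (h : winCheckP GB EB nb m d cZ RN P D 0 lo hi s = true) : WinOK GB EB nb m cZ RN P D lo hi s :=
  winOK_of_checkH0 hsort hrow (by rw [← winCheckP_eq_winCheckH hsort]; exact h)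

end

end Summit.QuantumFields.GaugeBoot.Certificates.Sparse
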